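import Mathlib
import Summits.Ventures.HodgeRepro.PeriodCloserC7Chain
import Summits.Ventures.HodgeRepro.PeriodCloserC7Stability

/-!
# PeriodCloserC7ClassesN1 — with the line classes chosen by reciprocity, the seesaw isometry N1 at a place IS (E3)
at that place

Blind re-derivation cell `pub-hodge-repro`, seat night-2 (gen 3).  Target tree path
`lean/Summits/Ventures/HodgeRepro/PeriodCloserC7ClassesN1.lean`.  Continues `PeriodCloserC7Chain.lean`
(`NormResidueData`, `E2_line_iff_rootNumber`), `PeriodCloserC7Places.lean` (`E3At`) and gen 1's
`PeriodCloserC7Stability.lean` (`E3At_of_model`).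

ROUTE-B §9.9 (d) opens: «With the lines chosen as in (c), N1 at `v` is `ε_v(χ′_0) ε_v(χ′_1) = ε_v(χ′_2) ε_v(χ′_3)`
(§9.4).»  On the kernel: the seesaw condition N1 — `W_0 ⊕ W_1 ≅ W_2 ⊕ W_3` — at a non-split place `v` is the equality
of the discriminant classes `ω_v(a_0 a_1) = ω_v(a_2 a_3)` of the two planes (a hermitian space over the local
quadratic extension is classified by its dimension and its discriminant class: Landherr / Jacobowitz, as pinned in
ROUTE-B §9.34), i.e. `ω_v(a_0) ω_v(a_1) = ω_v(a_2) ω_v(a_3)` (`N1At`); when the four classes satisfy (E2)'s local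
equations `ω_v(a_j) = ε_v(½, χ′_j)` (the reciprocity classes of `PeriodCloserC7LineClasses.lean`), this is EXACTLY
`E3At I v d` (`N1At_iff_E3At`, `N1_iff_E3`).  Combined with gen 1: at a place of `S₃` where the four local signs are
the model's ε-factors after the stability twist, N1 holds for the reciprocity classes (`N1At_of_model`).  Globally
the discriminant classes of both planes have product `1` over all places by reciprocity (`finprod_N1`).

**What this is not.**  `N1At` is the discriminant-class condition, stated as the route reads it; the local signs are
parameters; nothing about the octic face's characters is evaluated.  Nothing here says anything about the status of
the Hodge conjecture for CM abelian varieties, which is NOT proved.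
-/

set_option autoImplicit false

noncomputable section

namespace Summit.Ventures.HodgeRepro.PeriodCloser

open NumberField

variable {L : Type} [Field L] [NumberField L] [IsCMField L]

/-- **N1 at `v` for the classes `a`**: the two planes `W_0 ⊕ W_1`, `W_2 ⊕ W_3` have the same discriminant class at `v`
(`ω_v(a_0) ω_v(a_1) = ω_v(a_2) ω_v(a_3)`) — the local seesaw isometry condition, hermitian spaces over the local
quadratic extension being classified by dimension and discriminant (ROUTE-B §9.34). -/
def N1At {Place : Type} (D : NormResidueData Place) (a : Fin 4 → D.Global) (v : Place) : Prop :=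
  D.omega (a 0) v * D.omega (a 1) v = D.omega (a 2) v * D.omega (a 3) v

/-- **N1 at `v` is (E3) at `v`** once the classes satisfy (E2)'s local equations at `v`. -/
theorem N1At_iff_E3At (I : C7Face L) (D : NormResidueData I.Place) (a : Fin 4 → D.Global) (d : I.Datum)
    (v : I.Place) (h : ∀ j : Fin 4, D.omega (a j) v = I.localRootNumber v (I.chars d j)) :
    N1At D a v ↔ E3At I v d := by
  unfold N1At E3At
  rw [h 0, h 1, h 2, h 3]

/-- **N1 at every place is (E3)** for classes satisfying (E2)'s local equations everywhere. -/
theorem N1_iff_E3 (I : C7Face L) (D : NormResidueData I.Place) (a : Fin 4 → D.Global) (d : I.Datum)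
    (h : ∀ (j : Fin 4) (v : I.Place), D.omega (a j) v = I.localRootNumber v (I.chars d j)) :
    (∀ v : I.Place, N1At D a v) ↔ I.E3 d := by
  constructor
  · intro hN v
    exact (N1At_iff_E3At I D a d v fun j => h j v).mp (hN v)
  · intro hE v
    exact (N1At_iff_E3At I D a d v fun j => h j v).mpr (hE v)

/-- **N1 at a place of `S₃` from the stability twist** (gen 1's `E3At_of_model` + `N1At_iff_E3At`): if the four local
signs at `v` are the model's ε-factors of the four lines twisted by one primitive `ρ`, the lines are shallow and N2
holds at `v`, then the reciprocity classes satisfy N1 at `v`. -/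
theorem N1At_of_model {R : Type} [CommRing R] [Fintype R] (I : C7Face L) (D : NormResidueData I.Place)
    (a : Fin 4 → D.Global) (d : I.Datum) (v : I.Place)
    (h : ∀ j : Fin 4, D.omega (a j) v = I.localRootNumber v (I.chars d j))
    (κ : ℂ) (n : ℕ) (χ' : Fin 4 → LocalChar R) (ρ : LocalChar R) (ψ : AddChar R ℂ) (J : Ideal R)
    (hJ : ∀ z ∈ J, ∀ z' ∈ J, z * z' = 0) (b : Rˣ) (hρ : LocalChar.Primitive ψ J ρ b)
    (hχ : ∀ j, LocalChar.Shallow ψ J (χ' j)) (hN2 : χ' 0 * χ' 1 = χ' 2 * χ' 3)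
    (he : ∀ j, ((I.localRootNumber v (I.chars d j) : ℤ) : ℂ) = LocalChar.eps κ n (χ' j * ρ) ψ) :
    N1At D a v :=
  (N1At_iff_E3At I D a d v h).mpr (E3At_of_model I v d κ n χ' ρ ψ J hJ b hρ hχ hN2 he)

/-- **The global discriminant condition is automatic**: the product over all places of each plane's discriminant
class is `1` (Hilbert reciprocity for `a_0 a_1` and for `a_2 a_3`), so N1 at all places is a condition on the local
classes only — the one `N1_iff_E3` turns into (E3). -/
theorem finprod_N1 {Place : Type} (D : NormResidueData Place) (a : Fin 4 → D.Global) :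
    (∏ᶠ v, D.omega (a 0) v * D.omega (a 1) v) = 1 ∧ (∏ᶠ v, D.omega (a 2) v * D.omega (a 3) v) = 1 := by
  constructor
  · rw [finprod_mul_distrib (D.finite (a 0)) (D.finite (a 1)), D.product_one, D.product_one, one_mul]
  · rw [finprod_mul_distrib (D.finite (a 2)) (D.finite (a 3)), D.product_one, D.product_one, one_mul]

/-- N1 at a split place is automatic when the local symbols are trivial there (`ω_v` trivial on a split `v`). -/
theorem N1At_of_split {Place : Type} (D : NormResidueData Place) (a : Fin 4 → D.Global) (v : Place)
    (hω : ∀ g : D.Global, D.omega g v = 1) : N1At D a v := by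
  unfold N1At
  rw [hω, hω, hω, hω]

end Summit.Ventures.HodgeRepro.PeriodCloser

end
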